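import Summits.BirchSwinnertonDyer.BirchSwinnertonDyer.Theorems.GenusKolyvaginAtTwoVisiblePairAtTwoDefs
import HarnessLib

/-!
# Route `GenusKolyvaginAtTwo`, LINE 6, KEY crux Q3 (inner statement of stmt-BirchSwinnertonDyer-22137):
# the DERIVED AXIOMS of the visible pair descent at `2` over `ℚ` — fields `duality₁/₂`, `mem_loc₁/₂_pl_iff`,
# `c_mem_loc_iff₁₂/₂₁` of `KolyvaginDescent.VisiblePairHypothesesM` for the objects of `…VisiblePairAtTwoDefs`

Helper (seat `bsd-line-gk2-p3` g12; `--supports` the crux, closes nothing). For the concrete objects of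
`Theorems/GenusKolyvaginAtTwoVisiblePairAtTwoDefs.lean` (`loc₁/₂ = selmerLocalKer`, `a₁/₂ = torsionLocalKer` at `v_ℓ`,
`rK₁ = [res ·, ·]`, `rK₂ = [hPsiKT (res ·), ·]`, `locK ℓ` = vanishing on the inertia above `ℓ`, `kolPrime`) and displayed
inputs `I : Input W K M hθ hθsq`, this file proves the six non-trivial axioms of gk2-p2's `VisiblePairHypothesesM`
(p632473) in exactly their field shapes, each a re-indexing of one brick of this lineage:

* `duality₁_field` ← `…DualityRat.lemma_5_3_rat_two`; `duality₂_field` ← `…TwinDualityRat.lemma_5_3_rat_two_quadraticTwist`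
  (McCallum Lemma 5.3 + Prop. 2.2 over `ℚ_ℓ`, unconditional);
* `mem_loc₁_pl_iff_field`, `mem_loc₂_pl_iff_field` ← `…SelmerConditionVisible` (the Selmer condition at `v_ℓ` read on
  `Γ_{K(E_K[2^M])}`; inertia above `ℓ` fixes `E_K[2^M]`);
* `c_mem_loc_iff₁₂_field`, `c_mem_loc_iff₂₁_field` ← `…PropFourFourRat` (Prop. 4.4 over `ℚ` from the `K`-level relation
  `I.rel`; the twin's `Δ < 0` and depth-`2^M` Frobenius condition from `E`'s by `…TwinGrossPrimes`).

The instance itself (`visiblePair I`, a `def`) is the sibling `…VisiblePairAtTwoInstanceDefs`. THEOREMS ONLY (no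
definition, no named fact, no `sorry`, standard axioms). BSD is not proved by any of this; Q2, (H2), Lemma 4.3 over `ℚ`
and the visible Čebotarev remain displayed inputs.

References: [McCallumLMS1991] p. 299, §4 Lemma 4.3, Prop. 4.4, §5 Lemma 5.3, §2 Prop. 2.2; [GrossLMS1991] §3, §9;
[Kolyvagin1989Izv] §3.
-/

set_option autoImplicit false
set_option linter.dupNamespace false -- tree convention: `Summit.BirchSwinnertonDyer.BirchSwinnertonDyer.Theorems` (summit = sub-problem)

noncomputable section

open scoped Classical

namespace Summit.BirchSwinnertonDyer.BirchSwinnertonDyer.Theorems.GenusExact.VisiblePairAtTwo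

open WeierstrassCurve NumberField IsDedekindDomain Field Rat.HeightOneSpectrum
open Literature.NumberTheory.EllipticCurves Literature.NumberTheory.GaloisRepresentations
open Literature.NumberTheory.EllipticCurves.KolyvaginDescent
open Summit.BirchSwinnertonDyer.BirchSwinnertonDyer.Theorems.GenusExact.FrobeniusCriterion
open Summit.BirchSwinnertonDyer.BirchSwinnertonDyer.Theorems.GenusExact.SelmerDescent
open Summit.BirchSwinnertonDyer.BirchSwinnertonDyer.Theorems.GenusExact.TwinGrossPrimes

section Fields

variable {W : WeierstrassCurve ℚ} [W.IsElliptic] [W.IsGloballyMinimal] {K : Type} [Field K] [NumberField K]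
  {M : ℕ} {θ : K} {hθ : θ ∉ Set.range (algebraMap ℚ K)}
  {hθsq : θ ^ 2 = algebraMap ℚ K ((NumberField.discr K : ℤ) : ℚ)}

variable [(twin W K).IsElliptic] (I : Input W K M hθ hθsq)

include I in
omit [(twin W K).IsElliptic] in
/-- **Field `duality₁`** of the instance (`lemma_5_3_rat_two`). [cite: McCallumLMS1991, §5 Lemma 5.3 and §2 Prop. 2.2] -/
theorem duality₁_field (ℓ : ℕ) (hKol : kolPrime W K M ℓ) (d : galH1Torsion W (lvl M))
    (hd : ∀ P, P ≠ pl ℓ → d ∈ loc₁ W M P) (s : galH1Torsion W (lvl M)) (hs : s ∈ selmerGroup W (lvl M))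
    (a : ℕ) (hda : ((2 : ℤ) ^ a) • d ∉ loc₁ W M (pl ℓ)) : ((2 : ℤ) ^ (M - 1 - a)) • s ∈ a₁ W M ℓ := by
  obtain ⟨hℓ, hℓ2, -, hgood, -, hF2, hMi, -⟩ := hKol
  haveI : Fact ℓ.Prime := ⟨hℓ⟩
  haveI : NeZero (2 ^ M) := ⟨pow_ne_zero M two_ne_zero⟩
  rw [mem_a₁_iff hℓ]
  rw [pl_of_prime hℓ] at hd hda
  exact lemma_5_3_rat_two W I.hΔ I.hM rfl hℓ2 (natCast_mem_primesEquiv_symm hℓ) hgood hF2 hMi hs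
    (fun w hw ↦ hd (Sum.inl w) fun h ↦ hw (Sum.inl_injective h)) (fun w ↦ hd (Sum.inr w) Sum.inr_ne_inl)
    hda

include I in
/-- **Field `duality₂`** of the instance (`lemma_5_3_rat_two_quadraticTwist`). [cite: McCallumLMS1991, §5 Lemma 5.3 and §2 Prop. 2.2] -/
theorem duality₂_field (ℓ : ℕ) (hKol : kolPrime W K M ℓ) (d : galH1Torsion (twin W K) (lvl M))
    (hd : ∀ P, P ≠ pl ℓ → d ∈ loc₂ W K M P) (s : galH1Torsion (twin W K) (lvl M))
    (hs : s ∈ selmerGroup (twin W K) (lvl M)) (a : ℕ) (hda : ((2 : ℤ) ^ a) • d ∉ loc₂ W K M (pl ℓ)) :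
    ((2 : ℤ) ^ (M - 1 - a)) • s ∈ a₂ W K M ℓ := by
  obtain ⟨hℓ, hℓ2, hℓd, hgood, -, hF2, hMi, -⟩ := hKol
  haveI : Fact ℓ.Prime := ⟨hℓ⟩
  haveI : NeZero (2 ^ M) := ⟨pow_ne_zero M two_ne_zero⟩
  rw [mem_a₂_iff hℓ]
  rw [pl_of_prime hℓ] at hd hda
  exact lemma_5_3_rat_two_quadraticTwist W I.hK I.hodd I.hΔ I.hM rfl hℓ2 hℓd hgood hF2
    (natCast_mem_primesEquiv_symm hℓ) hMi hs
    (fun w hw ↦ hd (Sum.inl w) fun h ↦ hw (Sum.inl_injective h)) (fun w ↦ hd (Sum.inr w) Sum.inr_ne_inl)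
    hda

include I in
omit [(twin W K).IsElliptic] in
/-- **Field `mem_loc₁_pl_iff`** of the instance (`mem_selmerLocalKer_iff_forall_h1Eval_resTorsion_eq_zero`): the
Selmer condition of `E` at `v_ℓ` is read on `ρ ↦ [res u, ρ]`. [cite: McCallumLMS1991, p. 299 and §4 Lemma 4.3] -/
theorem mem_loc₁_pl_iff_field (ℓ : ℕ) (hKol : kolPrime W K M ℓ) (u : galH1Torsion W (lvl M)) :
    u ∈ loc₁ W M (pl ℓ) ↔ rK₁ W K M u ∈ locK W K M ℓ := by
  obtain ⟨hℓ, hv, h2v, hqv, hdv⟩ := local_data hKol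
  obtain ⟨hℓ', -, -, hgood, -⟩ := hKol
  haveI : Fact ℓ.Prime := ⟨hℓ⟩
  set v : HeightOneSpectrum (𝓞 ℚ) := primesEquiv.symm ⟨ℓ, hℓ⟩ with hvdef
  have hgoodv : W.HasGoodReductionAt v := hasGoodReductionAt_of_hasGoodReductionAtPrime W hgood hv
  rw [pl_of_prime hℓ, mem_locK_iff]
  change u ∈ selmerLocalKer W (v.adicCompletion ℚ) (lvl M) ↔ _
  constructor
  · intro hu w hw 𝔔 h𝔔 ρ hρ
    haveI := liesOver_of_natCast_mem hℓ hv hw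
    exact (mem_selmerLocalKer_iff_forall_h1Eval_resTorsion_eq_zero W I.hK.1 (not_mem_range hθ) hθsq
      (lvl M) v w hgoodv hqv h2v hdv h𝔔 u).mp hu ρ hρ
  · intro h
    obtain ⟨w, hw⟩ := exists_natCast_mem (K := K) hℓ
    haveI := liesOver_of_natCast_mem hℓ hv hw
    obtain ⟨𝔔, h𝔔⟩ := w.primesAbove_nonempty
    refine (mem_selmerLocalKer_iff_forall_h1Eval_resTorsion_eq_zero W I.hK.1 (not_mem_range hθ) hθsq
      (lvl M) v w hgoodv hqv h2v hdv h𝔔 u).mpr fun τ hτ ↦ ?_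
    have hτT : τ ∈ torsionFixing (W.baseChange K) (lvl M) :=
      inertia_le_torsionFixing_of_hasGoodReductionAt (W.baseChange K) w
        (hasGoodReductionAt_baseChange_of_hasGoodReductionAt W K v w hgoodv)
        (intCast_notMem_of_liesOver K v w hqv) h𝔔 hτ
    exact h w hw 𝔔 h𝔔 ⟨τ, hτT⟩ hτ

include I in
/-- **Field `mem_loc₂_pl_iff`** of the instance (`mem_selmerLocalKer_twist_iff_forall_h1Eval_hPsiKT_eq_zero`): the
Selmer condition of the twin at `v_ℓ` is read on `ρ ↦ [hPsiKT (res y), ρ]`. [cite: McCallumLMS1991, p. 299 and §4 Lemma 4.3] -/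
theorem mem_loc₂_pl_iff_field (ℓ : ℕ) (hKol : kolPrime W K M ℓ) (y : galH1Torsion (twin W K) (lvl M)) :
    y ∈ loc₂ W K M (pl ℓ) ↔ rK₂ W M hθ hθsq y ∈ locK W K M ℓ := by
  obtain ⟨hℓ, hv, h2v, hqv, hdv⟩ := local_data hKol
  obtain ⟨hℓ', -, hℓd, hgood, -⟩ := hKol
  haveI : Fact ℓ.Prime := ⟨hℓ⟩
  set v : HeightOneSpectrum (𝓞 ℚ) := primesEquiv.symm ⟨ℓ, hℓ⟩ with hvdef
  have hgoodv : W.HasGoodReductionAt v := hasGoodReductionAt_of_hasGoodReductionAtPrime W hgood hv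
  have hgood'v : (twin W K).HasGoodReductionAt v :=
    hasGoodReductionAt_of_hasGoodReductionAtPrime (twin W K)
      (hasGoodReductionAtPrime_of_smul_quadraticTwist_eq W I.hK.1 I.hodd (twin W K) (one_smul _ _) hℓd
        hgood) hv
  rw [pl_of_prime hℓ, mem_locK_iff]
  change y ∈ selmerLocalKer (twin W K) (v.adicCompletion ℚ) (lvl M) ↔ _
  constructor
  · intro hy w hw 𝔔 h𝔔 ρ hρ
    haveI := liesOver_of_natCast_mem hℓ hv hw
    exact (mem_selmerLocalKer_twist_iff_forall_h1Eval_hPsiKT_eq_zero W I.hK.1 (not_mem_range hθ) hθsq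
      hθ hθsq (lvl M) v w hgoodv hgood'v hqv h2v hdv h𝔔 y).mp hy ρ hρ
  · intro h
    obtain ⟨w, hw⟩ := exists_natCast_mem (K := K) hℓ
    haveI := liesOver_of_natCast_mem hℓ hv hw
    obtain ⟨𝔔, h𝔔⟩ := w.primesAbove_nonempty
    refine (mem_selmerLocalKer_twist_iff_forall_h1Eval_hPsiKT_eq_zero W I.hK.1 (not_mem_range hθ) hθsq
      hθ hθsq (lvl M) v w hgoodv hgood'v hqv h2v hdv h𝔔 y).mpr fun τ hτ ↦ ?_
    have hτT : τ ∈ torsionFixing (W.baseChange K) (lvl M) :=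
      inertia_le_torsionFixing_of_hasGoodReductionAt (W.baseChange K) w
        (hasGoodReductionAt_baseChange_of_hasGoodReductionAt W K v w hgoodv)
        (intCast_notMem_of_liesOver K v w hqv) h𝔔 hτ
    exact h w hw 𝔔 h𝔔 ⟨τ, hτT⟩ hτ

include I in
/-- **Field `c_mem_loc_iff₁₂`** of the instance (`zsmul_twist_mem_selmerLocalKer_iff_zsmul_mem_torsionLocalKer_of_K`):
Prop. 4.4 over `ℚ` from even depth `m` to odd depth `ℓm`, from the `K`-level relation `I.rel`.
[cite: McCallumLMS1991, §4 Prop. 4.4] -/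
theorem c_mem_loc_iff₁₂_field (ℓ m : ℕ) (hKol : kolPrime W K M ℓ) (hℓm : KolSupp (kolPrime W K M) (ℓ * m))
    (heven : Even m.primeFactors.card) (a : ℕ) :
    ((2 : ℤ) ^ a) • I.c₂ (ℓ * m) ∈ loc₂ W K M (pl ℓ) ↔ ((2 : ℤ) ^ a) • I.c₁ m ∈ a₁ W M ℓ := by
  obtain ⟨hℓ, hv, -, -, hdv⟩ := local_data hKol
  obtain ⟨hℓ', hℓ2, hℓd, hgood, hFq, -, -, hf⟩ := id hKol
  haveI : Fact ℓ.Prime := ⟨hℓ⟩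
  set v : HeightOneSpectrum (𝓞 ℚ) := primesEquiv.symm ⟨ℓ, hℓ⟩ with hvdef
  have hgoodv : W.HasGoodReductionAt v := hasGoodReductionAt_of_hasGoodReductionAtPrime W hgood hv
  have hgood'v : (twin W K).HasGoodReductionAt v :=
    hasGoodReductionAt_of_hasGoodReductionAtPrime (twin W K)
      (hasGoodReductionAtPrime_of_smul_quadraticTwist_eq W I.hK.1 I.hodd (twin W K) (one_smul _ _) hℓd
        hgood) hv
  obtain ⟨w, hw⟩ := exists_natCast_mem (K := K) hℓ
  haveI := liesOver_of_natCast_mem hℓ hv hw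
  have hm : KolSupp (kolPrime W K M) m := (kolSupp_of_prime_mul hℓ hℓm).1
  have hodd : Odd (ℓ * m).primeFactors.card := (odd_card_primeFactors_mul_iff hℓ hℓm).mpr heven
  rw [pl_of_prime hℓ, mem_a₁_iff hℓ]
  change ((2 : ℤ) ^ a) • I.c₂ (ℓ * m) ∈ selmerLocalKer (twin W K) (v.adicCompletion ℚ) (lvl M) ↔ _
  exact zsmul_twist_mem_selmerLocalKer_iff_zsmul_mem_torsionLocalKer_of_K W I.hΔ I.hM rfl hℓ hℓ2 hv hgoodv
    I.hK.1 (not_mem_range hθ) hθsq hdv hFq w (hf w hw) hθ hθsq hgood'v (I.res_c₁ m hm heven)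
    (I.res_c₂ (ℓ * m) hℓm hodd) ((2 : ℤ) ^ a) (I.rel ℓ m hKol hℓm w hw a)

include I in
/-- **Field `c_mem_loc_iff₂₁`** of the instance (`zsmul_mem_selmerLocalKer_iff_zsmul_twist_mem_torsionLocalKer_of_K`):
Prop. 4.4 over `ℚ` from odd depth `m` to even depth `ℓm` (the twin's `Δ < 0` and Gross's (3.2) at depth `2^M` come
from `E`'s by `…TwinGrossPrimes`). [cite: McCallumLMS1991, §4 Prop. 4.4] -/
theorem c_mem_loc_iff₂₁_field (ℓ m : ℕ) (hKol : kolPrime W K M ℓ) (hℓm : KolSupp (kolPrime W K M) (ℓ * m))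
    (hoddm : Odd m.primeFactors.card) (a : ℕ) :
    ((2 : ℤ) ^ a) • I.c₁ (ℓ * m) ∈ loc₁ W M (pl ℓ) ↔ ((2 : ℤ) ^ a) • I.c₂ m ∈ a₂ W K M ℓ := by
  obtain ⟨hℓ, hv, -, -, hdv⟩ := local_data hKol
  obtain ⟨hℓ', hℓ2, hℓd, hgood, hFq, -, -, hf⟩ := id hKol
  haveI : Fact ℓ.Prime := ⟨hℓ⟩
  set v : HeightOneSpectrum (𝓞 ℚ) := primesEquiv.symm ⟨ℓ, hℓ⟩ with hvdef
  have hd0 : ((NumberField.discr K : ℤ) : ℚ) ≠ 0 := by exact_mod_cast NumberField.discr_ne_zero K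
  have hgoodv : W.HasGoodReductionAt v := hasGoodReductionAt_of_hasGoodReductionAtPrime W hgood hv
  have hgood'v : (twin W K).HasGoodReductionAt v :=
    hasGoodReductionAt_of_hasGoodReductionAtPrime (twin W K)
      (hasGoodReductionAtPrime_of_smul_quadraticTwist_eq W I.hK.1 I.hodd (twin W K) (one_smul _ _) hℓd
        hgood) hv
  have hΔ' : (twin W K).Δ < 0 := Δ_neg_of_smul_quadraticTwist_eq W hd0 (twin W K) (one_smul _ _) I.hΔ
  have hFq' : FrobEqFrobInfty (twin W K) K (2 ^ M) ℓ :=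
    frobEqFrobInfty_of_smul_quadraticTwist_eq W I.hK (twin W K) (one_smul _ _) hFq
  obtain ⟨w, hw⟩ := exists_natCast_mem (K := K) hℓ
  haveI := liesOver_of_natCast_mem hℓ hv hw
  have hm : KolSupp (kolPrime W K M) m := (kolSupp_of_prime_mul hℓ hℓm).1
  have heven : Even (ℓ * m).primeFactors.card := (even_card_primeFactors_mul_iff hℓ hℓm).mpr hoddm
  rw [pl_of_prime hℓ, mem_a₂_iff hℓ]
  change ((2 : ℤ) ^ a) • I.c₁ (ℓ * m) ∈ selmerLocalKer W (v.adicCompletion ℚ) (lvl M) ↔ _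
  exact zsmul_mem_selmerLocalKer_iff_zsmul_twist_mem_torsionLocalKer_of_K W I.hM rfl hℓ hℓ2 hv hgoodv I.hK.1
    (not_mem_range hθ) hθsq hdv w (hf w hw) hθ hθsq hΔ' hgood'v hFq' (I.res_c₁ (ℓ * m) hℓm heven)
    (I.res_c₂ m hm hoddm) ((2 : ℤ) ^ a) (I.rel ℓ m hKol hℓm w hw a)

end Fields

end Summit.BirchSwinnertonDyer.BirchSwinnertonDyer.Theorems.GenusExact.VisiblePairAtTwo

end
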